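import Mathlib
import Summits.Ventures.HodgeRepro2.T6NAut2View
import Summits.Ventures.HodgeRepro2.T6NAut3

/-!
# T6NAut3View — the forgetful view of a v3 carrier as a v1 carrier over the period datum with
admissibility forgotten (TARGET-T6 v0.6 §9.2(b), v3 — the owners' side-level mains apply unchanged)

Cell pub-hodge-repro2, Tier 6 (README §10), seat t6-lead (gen 4). T6NAut2View (p402390) verbatim
over the re-cut carrier `NAut3 F P` (T6NAut3): `NDatum.trivialAdm` is REUSED from T6NAut2View (not
redefined), and `M.toNAut' hex : NAut F P.trivialAdm` has `d3`, `sA`, `sB`, `ι5`, `G5`, `d5` equal to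
`M`'s BY `rfl`, so the owners' SIDE-LEVEL v1 mains — N3A / N3B over `d3` (t6-p3's `N3A_main` /
`N3B_main`), N4 over `sA` / `sB` (t6-p4's `N4_main`) — apply to a v3 carrier unchanged, and their
conclusions `(M.toNAut' hex).iA` etc. ARE `M.iA` etc. (`toNAut'_iA` … are `rfl`). `hex` («every
quadruple of Schwartz data is the data of SOME choice, admissible or not») is the v2 binder of class
EX — by construction on the host, where `data` is a projection of the choice tuple. NOT for N1: the
view's `d1` is the transported one and `AdmChoice ≡ True` would turn N1's displays into assumptions
on non-admissible choices — N1 is consumed on `M.d1` over the ORIGINAL `P`. The view does not touch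
the re-cut field `data_adm'` (v1's `data_surj` of the view is `hex` over the trivial admissibility —
exactly T6NAut2View's construction, and t6-p1's T6N1Obstruction does not apply to it: its N1
displays are never assumed on the view).

§8(d): uses an L-value-free non-vanishing device: NO.
-/

namespace Summit.Ventures.HodgeRepro2.T6

variable {K : Type*} [Field K] [NumberField K] [NumberField.IsCMField K]

namespace NAut3

variable {F : FaceSetting K} {P : NDatum F} (M : NAut3 F P)

/-- THE FORGETFUL VIEW: the v1 carrier over `P.trivialAdm`, given that every quadruple of Schwartz
data is the data of some choice (`hex`). Its `d3`, `sA`, `sB`, `ι5`, `G5`, `d5` are `M`'s by `rfl`. -/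
def toNAut' (hex : ∀ (φa : M.d3.A.Sa) (φb : M.d3.A.Sb) (φc : M.d3.B.Sa) (φd : M.d3.B.Sb),
    ∃ c, M.data c = (φa, φb, φc, φd)) : NAut F P.trivialAdm where
  d3 := M.d3
  data := M.data
  data_surj φa φb φc φd := (hex φa φb φc φd).imp fun _ h => ⟨trivial, h⟩
  d1 := { conj := M.d1.conj, conj_smul := M.d1.conj_smul, conj_conj := M.d1.conj_conj,
          H10 := M.d1.H10, sc := M.d1.sc, cK := M.d1.cK, cK_pos := M.d1.cK_pos }
  sA := M.sA
  sB := M.sB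
  ι5 := M.ι5
  G5 := M.G5
  instG5 := M.instG5
  d5 := M.d5
  hypII_A_of_N5 := M.hypII_A_of_N5
  hypII_B_of_N5 := M.hypII_B_of_N5

variable (hex : ∀ (φa : M.d3.A.Sa) (φb : M.d3.A.Sb) (φc : M.d3.B.Sa) (φd : M.d3.B.Sb),
    ∃ c, M.data c = (φa, φb, φc, φd))

/-- `toNAut'` keeps the N3 datum. -/
theorem toNAut'_d3 : (M.toNAut' hex).d3 = M.d3 := rfl

/-- `toNAut'` keeps the N4 data of side A. -/
theorem toNAut'_sA : (M.toNAut' hex).sA = M.sA := rfl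

/-- `toNAut'` keeps the N4 data of side B. -/
theorem toNAut'_sB : (M.toNAut' hex).sB = M.sB := rfl

/-- `toNAut'` keeps the N5 datum. -/
theorem toNAut'_d5 : (M.toNAut' hex).d5 = M.d5 := rfl

/-- (i) on side A reads the same through `toNAut'`. -/
theorem toNAut'_iA : (M.toNAut' hex).iA = M.iA := rfl

/-- (i) on side B reads the same through `toNAut'`. -/
theorem toNAut'_iB : (M.toNAut' hex).iB = M.iB := rfl

/-- (ii) on side A reads the same through `toNAut'`. -/
theorem toNAut'_iiA : (M.toNAut' hex).iiA = M.iiA := rfl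

/-- (ii) on side B reads the same through `toNAut'`. -/
theorem toNAut'_iiB : (M.toNAut' hex).iiB = M.iiB := rfl

/-- `ℓ_A ≠ 0` reads the same through `toNAut'`. -/
theorem toNAut'_ellA : (M.toNAut' hex).ellA = M.ellA := rfl

/-- `ℓ_B ≠ 0` reads the same through `toNAut'`. -/
theorem toNAut'_ellB : (M.toNAut' hex).ellB = M.ellB := rfl

/-- N4's conclusion reads the same through `toNAut'`. -/
theorem toNAut'_N4 : (M.toNAut' hex).N4 = M.N4 := rfl

/-- N5's conclusion reads the same through `toNAut'`. -/
theorem toNAut'_N5 : (M.toNAut' hex).N5 = M.N5 := rfl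

/-- The pairing reads the same through `toNAut'`. -/
theorem toNAut'_pairing (c : P.Choice) : (M.toNAut' hex).pairing c = M.pairing c := rfl

/-- A v1 carrier's `data_surj` gives `hex` for the v2 carrier `ofNAut M₁ d2`. -/
theorem ofNAut_hex (M₁ : NAut F P) (d2 : N2Datum F P M₁.d3) :
    ∀ (φa : M₁.d3.A.Sa) (φb : M₁.d3.A.Sb) (φc : M₁.d3.B.Sa) (φd : M₁.d3.B.Sb),
      ∃ c, (ofNAut M₁ d2).data c = (φa, φb, φc, φd) :=
  fun φa φb φc φd => (M₁.data_surj φa φb φc φd).imp fun _ h => h.2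

/-- The forgetful view of a v3 carrier as a V2 carrier over `P.trivialAdm`: v2's `data_adm` is `hex`
over the trivial admissibility (exactly as `toNAut'`'s `data_surj`), `d2` is `M.d2` rebuilt field by
field (its parameter `P` is phantom: no field of `N2Datum` mentions `P`), and `d3`, `sA`, `sB`, `ι5`,
`G5`, `d5` are `M`'s by `rfl`. For the owners' mains STATED OVER `NAut2` — t6-p5's
`N2ToyIso.N2_main_explicit` and t6-p3's `N3Main.N3iso_main₂` — whose statements read only `d2` / `d3`:
their conclusions on the view ARE `M.AdmDatum`, `M.AdmData`, `M.ellA` … (`toNAut2'_admDatum` … are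
`rfl`). NOT for N1 (the view's `d1` is the transported one — N1 is consumed on `M.d1` over `P`), and
the view's `data_adm` is never the object of a display: t6-p1's T6N1Obstruction does not apply to it. -/
def toNAut2' (hex : ∀ (φa : M.d3.A.Sa) (φb : M.d3.A.Sb) (φc : M.d3.B.Sa) (φd : M.d3.B.Sb),
    ∃ c, M.data c = (φa, φb, φc, φd)) : NAut2 F P.trivialAdm where
  d3 := M.d3
  data := M.data
  d2 := { τ := M.d2.τ, e₁₁₁ := M.d2.e₁₁₁, e₁₀₀ := M.d2.e₁₀₀, u := M.d2.u, Char := M.d2.Char,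
          instCommGroupChar := M.d2.instCommGroupChar, χ₁₁₁ := M.d2.χ₁₁₁, χ₁₀₀ := M.d2.χ₁₀₀,
          admA := M.d2.admA, admB := M.d2.admB, admC := M.d2.admC, admD := M.d2.admD }
  data_adm _ φa φb φc φd _ := (hex φa φb φc φd).imp fun _ h => ⟨trivial, h⟩
  d1 := { conj := M.d1.conj, conj_smul := M.d1.conj_smul, conj_conj := M.d1.conj_conj,
          H10 := M.d1.H10, sc := M.d1.sc, cK := M.d1.cK, cK_pos := M.d1.cK_pos }
  sA := M.sA
  sB := M.sB
  ι5 := M.ι5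
  G5 := M.G5
  instG5 := M.instG5
  d5 := M.d5
  hypII_A_of_N5 := M.hypII_A_of_N5
  hypII_B_of_N5 := M.hypII_B_of_N5

section v2view

variable (hex : ∀ (φa : M.d3.A.Sa) (φb : M.d3.A.Sb) (φc : M.d3.B.Sa) (φd : M.d3.B.Sb),
    ∃ c, M.data c = (φa, φb, φc, φd))

/-- the v2 view's N3 datum is `M`'s -/
theorem toNAut2'_d3 : (M.toNAut2' hex).d3 = M.d3 := rfl

/-- the v2 view's N2 conclusion is `M`'s -/
theorem toNAut2'_admDatum : (M.toNAut2' hex).AdmDatum = M.AdmDatum := rfl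

/-- the v2 view's admissible quadruples are `M`'s -/
theorem toNAut2'_admData (φ : M.d3.A.Sa × M.d3.A.Sb × M.d3.B.Sa × M.d3.B.Sb) :
    (M.toNAut2' hex).AdmData φ = M.AdmData φ := rfl

/-- the v2 view's `ℓ_A ≠ 0` is `M`'s -/
theorem toNAut2'_ellA : (M.toNAut2' hex).ellA = M.ellA := rfl

/-- the v2 view's `ℓ_B ≠ 0` is `M`'s -/
theorem toNAut2'_ellB : (M.toNAut2' hex).ellB = M.ellB := rfl

/-- the v2 view keeps the pairing -/
theorem toNAut2'_pairing (c : P.Choice) : (M.toNAut2' hex).pairing c = M.pairing c := rfl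

end v2view

end NAut3

end Summit.Ventures.HodgeRepro2.T6
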